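import Summits.QuantumAdvantage.QuantumAdvantage.Theorems.RingSparseActivePattern

/-!
# Sparse-active strategies lose the ring game — part 3: the hole law and the sparse law

HOLE LAW `hole_loses` (core `window_free_loses`): a strategy on `C_N` whose ACTIVE outputs (outputs deviating, somewhere
on the odd class, from the canonical guess `t_k = x_k ⊕ x_{k+1}`) have `𝔽₃`-degree `≤ d` and all avoid some window
`[q, q + 48d·#active + 17)` with `q + 48d·#active + 17 ≤ N` loses on some odd pattern (the inactive outputs are unrestricted).
SPARSE LAW `sparse_active_loses` (hole law + pigeonhole `exists_free_block`): at most `K` active outputs of degree `≤ d`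
and `N ≥ (K+1)(48Kd+17)+2` ⇒ the strategy loses; `card_activeSet_gt_of_perfect`: a strategy perfect on the odd class
has more than `K ≈ √(N/(48d))` active outputs; `noPerfect_of_dense`: the dial form with the residual inlined.
Engine: trace form `WalkCoordinates.traceForm` on the double-comb family, `𝔽₃`-products over the active set
(`prod_one_add_ind`), the level-set vanishing lemma of part 1, and a three-residue parity count.
Source: decomp-qadv lens 2, generation 8 (node «SparseDial»).
-/

set_option linter.dupNamespace false -- D-0017: single-problem summit ⇒ QuantumAdvantage.QuantumAdvantage by design

namespace Summit.QuantumAdvantage.QuantumAdvantage.Theorems.RingSparseActive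

open Finset Module Literature.Computability.MetaComplexity Literature.Computability.MetaComplexity.Smolensky

/-! ## Stage 4: sparse-active strategies lose -/

section Strategy

open Summit.QuantumAdvantage.AdviceFreeQNC0 Literature.Computability.QuantumComplexity
  Literature.Computability.QuantumComplexity.RingHLF

variable {N : ℕ}

/-- The output bits `z_i = [P_i(x) = 1]` of an `𝔽₃`-polynomial strategy `P`. -/
def zOut (P : Fin N → CubeFn (ZMod 3) N) (x : Fin N → Bool) : Fin N → Bool := fun i => decide (P i x = 1)

/-- The set of ACTIVE outputs of `P`: output `k` is active iff somewhere on the odd class it deviates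
from the canonical guess `t_k(x) = x_k ⊕ x_{k+1}` (the guess that wins the whole even class and loses
every odd pattern, `RingCanonical.rel_tGuess_iff`). -/
noncomputable def activeSet (P : Fin N → CubeFn (ZMod 3) N) : Finset (Fin N) :=
  open scoped Classical in univ.filter fun k => ∃ x : Fin N → Bool, OddZeros x ∧ zOut P x k ≠ tGuess x k

open scoped Classical in
/-- Membership in the active set, unfolded. -/
theorem mem_activeSet (P : Fin N → CubeFn (ZMod 3) N) (k : Fin N) :
    k ∈ activeSet P ↔ ∃ x : Fin N → Bool, OddZeros x ∧ zOut P x k ≠ tGuess x k := by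
  simp [activeSet]

/-- `∏ (1 + [b_k]) = (-1)^{#{k : b_k}}` in `𝔽₃`. -/
theorem prod_one_add_ind {α : Type*} (S : Finset α) (b : α → Bool) :
    ∏ k ∈ S, (1 + (if b k = true then (1 : ZMod 3) else 0)) = (-1) ^ (S.filter fun k => b k = true).card := by
  have h : ∀ k ∈ S, (1 + (if b k = true then (1 : ZMod 3) else 0)) = if b k = true then -1 else 1 := by
    intro k _; split <;> decide
  rw [prod_congr rfl h, prod_ite, prod_const_one, mul_one, prod_const]

/-- `(-1)^n = -1` in `ZMod 3` forces `n` odd. -/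
theorem odd_of_neg_one_pow {n : ℕ} (h : (-1 : ZMod 3) ^ n = -1) : n % 2 = 1 := by
  rcases Nat.even_or_odd n with he | ho
  · rw [he.neg_one_pow] at h; exact absurd h (by decide)
  · exact Nat.odd_iff.1 ho

/-- The indicator `[Q = 1] = 2Q² + 2Q` has degree `≤ 2 deg Q`. -/
theorem ind_mem_lowDeg {n D : ℕ} {Q : CubeFn (ZMod 3) n} (hQ : Q ∈ lowDeg (ZMod 3) n D) :
    (fun w => if Q w = 1 then (1 : ZMod 3) else 0) ∈ lowDeg (ZMod 3) n (D + D) := by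
  have h : (fun w => if Q w = 1 then (1 : ZMod 3) else 0) = (2 : ZMod 3) • (Q * Q) + (2 : ZMod 3) • Q := by
    funext w
    simp only [Pi.add_apply, Pi.smul_apply, Pi.mul_apply, smul_eq_mul]
    generalize Q w = v
    revert v; decide
  rw [h]
  exact Submodule.add_mem _ (Submodule.smul_mem _ _ (mul_mem_lowDeg_add hQ hQ))
    (Submodule.smul_mem _ _ (lowDeg_mono (by omega) hQ))

/-- A natural number outside block `b` lies left or right of it. -/
theorem block_of_div_ne {B b k : ℕ} (hB : 0 < B) (h : k / B ≠ b) : k < b * B ∨ (b + 1) * B ≤ k := by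
  rcases Nat.lt_or_gt_of_ne h with h1 | h1
  · exact Or.inl ((Nat.div_lt_iff_lt_mul hB).1 h1)
  · exact Or.inr ((Nat.le_div_iff_mul_le hB).1 h1)

/-- The `u`-half of an appended parameter vector. -/
theorem uPart_append {m : ℕ} (u a : Fin m → Bool) : uPart m (Fin.append u a) = u := by
  funext j; exact Fin.append_left u a j

/-- The `a`-half of an appended parameter vector. -/
theorem aPart_append {m : ℕ} (u a : Fin m → Bool) : aPart m (Fin.append u a) = a := by
  funext j; exact Fin.append_right u a j

/-- Pigeonhole: a set of at most `K` positions misses one of the `K+1` blocks `[bB, (b+1)B)`. -/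
theorem exists_free_block (K B : ℕ) (hB : 0 < B) (S : Finset (Fin N)) (hS : S.card ≤ K) :
    ∃ b, b < K + 1 ∧ ∀ k ∈ S, k.val < b * B ∨ (b + 1) * B ≤ k.val := by
  classical
  have hlt : (S.image fun k : Fin N => k.val / B).card < (range (K + 1)).card := by
    rw [card_range]; exact lt_of_le_of_lt (card_image_le.trans hS) (Nat.lt_succ_self K)
  obtain ⟨b, hb, hbfree⟩ := exists_mem_notMem_of_card_lt_card hlt
  rw [mem_range] at hb
  exact ⟨b, hb, fun k hk => block_of_div_ne hB fun h => hbfree (mem_image.2 ⟨k, hk, h⟩)⟩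

/-- **Core: a window free of active outputs kills perfection.**  If the active outputs of `P` have degree
`≤ d`, number `≤ K`, and all lie outside the window `[p-2, p + 12·(2Δ+1) + 3)`, `Δ = 2dK`, of an `N`-cycle with
`p ≥ 1` and `p + 12(2Δ+1) + 3 ≤ N`, then `P` loses on some odd pattern (a double-comb pattern in that window). -/
theorem window_free_loses (d K N p : ℕ) (P : Fin N → CubeFn (ZMod 3) N)
    (hdeg : ∀ i ∈ activeSet P, P i ∈ lowDeg (ZMod 3) N d) (hcard : (activeSet P).card ≤ K) (hp1 : 1 ≤ p)
    (hpN : p + (6 * (2 * (K * (d + d)) + 1) + 1) + (6 * (2 * (K * (d + d)) + 1) + 1) + 1 ≤ N)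
    (hside : ∀ k ∈ activeSet P, k.val + 2 ≤ p ∨
      p + (6 * (2 * (K * (d + d)) + 1) + 1) + (6 * (2 * (K * (d + d)) + 1) + 1) + 1 ≤ k.val) :
    ∃ x : Fin N → Bool, OddZeros x ∧ ¬ Rel x (zOut P x) := by
  classical
  obtain ⟨Δ, hΔ⟩ : ∃ Δ, Δ = K * (d + d) := ⟨_, rfl⟩
  rw [← hΔ] at hpN hside
  have hm1 : 1 ≤ 2 * Δ + 1 := by omega
  have hmodd : Odd (2 * Δ + 1) := ⟨Δ, by omega⟩
  have hN3 : 3 ≤ N := by omega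
  -- suppose the strategy wins every odd pattern
  by_contra hcon
  push Not at hcon
  -- notation
  let x : (Fin ((2 * Δ + 1) + (2 * Δ + 1)) → Bool) → (Fin N → Bool) := pat N (2 * Δ + 1) p
  let ρ : (Fin ((2 * Δ + 1) + (2 * Δ + 1)) → Bool) → ℕ := fun w => ev (uPart (2 * Δ + 1) w) + ev (aPart (2 * Δ + 1) w)
  let resid : Fin N → ℕ → ℕ := fun k s => (k.val + N + (if p ≤ k.val then 2 * s else s)) % 3
  let Fk : (Fin ((2 * Δ + 1) + (2 * Δ + 1)) → Bool) → Fin N → Bool := fun w k => xor (zOut P (x w) k) (tGuess (x w) k)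
  have hρ : ∀ w, Wk (x w) (N - 1) % 3 = ρ w % 3 := by
    intro w
    show Wk (pat N (2 * Δ + 1) p w) (N - 1) % 3 = _
    rw [W_pat_mod hm1 w hpN, bx_eq_ev hmodd, bx_eq_ev hmodd]
  have hρle : ∀ w, ρ w ≤ 2 := fun w => by
    show ev _ + ev _ ≤ 2
    have := ev_le_one (uPart (2 * Δ + 1) w); have := ev_le_one (aPart (2 * Δ + 1) w); omega
  -- inactive outputs never flip on odd patterns
  have hinact : ∀ w k, k ∉ activeSet P → Fk w k = false := by
    intro w k hk
    rw [mem_activeSet] at hk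
    push Not at hk
    show xor (zOut P (x w) k) (tGuess (x w) k) = false
    rw [hk (x w) (oddZeros_pat hm1 w hpN), Bool.xor_self]
  -- the trace form on the family: an odd number of visible flips
  have hoddcard : ∀ w, (((activeSet P).filter fun k => resid k (ρ w) ≠ 2).filter
      fun k => Fk w k = true).card % 2 = 1 := by
    intro w
    have hrel := hcon (x w) (oddZeros_pat hm1 w hpN)
    rw [traceForm hN3 (x w) (oddZeros_pat hm1 w hpN)] at hrel
    have hset : (univ.filter fun k : Fin N => xor (zOut P (x w) k) (tGuess (x w) k) = true ∧
        (k.val + N + Wk (x w) k.val + Wk (x w) (N - 1)) % 3 ≠ 2) =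
        ((activeSet P).filter fun k => resid k (ρ w) ≠ 2).filter fun k => Fk w k = true := by
      ext k
      simp only [mem_filter, mem_univ, true_and]
      constructor
      · rintro ⟨h1, h2⟩
        have hk : k ∈ activeSet P := by
          by_contra hk
          have := hinact w k hk
          simp only [Fk] at this
          rw [this] at h1; exact Bool.false_ne_true h1
        refine ⟨⟨hk, ?_⟩, h1⟩
        rcases hside k hk with hl | hr
        · have hW : Wk (x w) k.val = 0 := Wk_pat_left w (by omega) (by omega)
          have h3 := hρ w
          simp only [resid, if_neg (show ¬ p ≤ k.val by omega)]
          intro h4; apply h2; omega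
        · have hW : Wk (x w) k.val = Wk (x w) (N - 1) := by
            show Wk (pat N (2 * Δ + 1) p w) k.val = Wk (pat N (2 * Δ + 1) p w) (N - 1)
            rw [Wk_pat_right hm1 w hpN (by omega) (by omega), Wk_pat_right hm1 w hpN (by omega) le_rfl]
          have h3 := hρ w
          simp only [resid, if_pos (show p ≤ k.val by omega)]
          intro h4; apply h2; omega
      · rintro ⟨⟨hk, h2⟩, h1⟩
        refine ⟨h1, ?_⟩
        rcases hside k hk with hl | hr
        · have hW : Wk (x w) k.val = 0 := Wk_pat_left w (by omega) (by omega)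
          have h3 := hρ w
          simp only [resid, if_neg (show ¬ p ≤ k.val by omega)] at h2
          intro h4; apply h2; omega
        · have hW : Wk (x w) k.val = Wk (x w) (N - 1) := by
            show Wk (pat N (2 * Δ + 1) p w) k.val = Wk (pat N (2 * Δ + 1) p w) (N - 1)
            rw [Wk_pat_right hm1 w hpN (by omega) (by omega), Wk_pat_right hm1 w hpN (by omega) le_rfl]
          have h3 := hρ w
          simp only [resid, if_pos (show p ≤ k.val by omega)] at h2
          intro h4; apply h2; omega
    rw [hset] at hrel
    exact hrel
  -- the product functions `G_s = ∏_{k ∈ S_s} (1 + [F_k])`, degree ≤ Δ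
  let Find : Fin N → CubeFn (ZMod 3) ((2 * Δ + 1) + (2 * Δ + 1)) := fun k w => if Fk w k = true then 1 else 0
  let G : ℕ → CubeFn (ZMod 3) ((2 * Δ + 1) + (2 * Δ + 1)) := fun s =>
    ∏ k ∈ (activeSet P).filter (fun k => resid k s ≠ 2), (1 + Find k)
  have hFind : ∀ k ∈ activeSet P, Find k ∈ lowDeg (ZMod 3) ((2 * Δ + 1) + (2 * Δ + 1)) (d + d) := by
    intro k hk
    have hQ : (fun w => P k (x w)) ∈ lowDeg (ZMod 3) ((2 * Δ + 1) + (2 * Δ + 1)) d :=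
      comp_subst_mem_lowDeg (pat N (2 * Δ + 1) p) (pat_literal N (2 * Δ + 1) p) (hdeg k hk)
    have hI := ind_mem_lowDeg hQ
    have htg : ∀ w, tGuess (x w) k = decide (N - 2 ≤ k.val) := fun w =>
      tGuess_pat w (by omega) hpN k (hside k hk)
    by_cases hc : N - 2 ≤ k.val
    · have hF : Find k = 1 - fun w => if P k (x w) = 1 then (1 : ZMod 3) else 0 := by
        funext w
        simp only [Find, Fk, zOut, htg w, decide_eq_true hc, Bool.xor_true, Pi.sub_apply, Pi.one_apply]
        by_cases hq : P k (x w) = 1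
        · simp [hq]
        · simp [hq]
      rw [hF]
      exact Submodule.sub_mem _ (one_mem_lowDeg _) hI
    · have hF : Find k = fun w => if P k (x w) = 1 then (1 : ZMod 3) else 0 := by
        funext w
        simp only [Find, Fk, zOut, htg w, decide_eq_false hc, Bool.xor_false]
        by_cases hq : P k (x w) = 1
        · simp [hq]
        · simp [hq]
      rw [hF]; exact hI
  have hG : ∀ s, G s ∈ lowDeg (ZMod 3) ((2 * Δ + 1) + (2 * Δ + 1)) Δ := by
    intro s
    have h1 : ∀ k ∈ (activeSet P).filter (fun k => resid k s ≠ 2), (1 + Find k) ∈ lowDeg (ZMod 3) ((2 * Δ + 1) + (2 * Δ + 1)) (d + d) :=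
      fun k hk => Submodule.add_mem _ (one_mem_lowDeg _) (hFind k (mem_filter.1 hk).1)
    have h2 := prod_mem_lowDeg ((activeSet P).filter fun k => resid k s ≠ 2) h1
    refine lowDeg_mono ?_ h2
    rw [hΔ]
    exact Nat.mul_le_mul_right _ ((card_filter_le _ _).trans hcard)
  -- evaluation of `G_s`
  have hGval : ∀ s w, G s w = (-1) ^ (((activeSet P).filter fun k => resid k s ≠ 2).filter
      fun k => Fk w k = true).card := by
    intro s w
    simp only [G, Finset.prod_apply, Pi.add_apply, Pi.one_apply, Find]
    exact prod_one_add_ind _ _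
  -- perfectness: `G_{ρ w} (w) = -1`
  have hperf : ∀ w, G (ρ w) w = -1 := by
    intro w
    rw [hGval, ← Nat.div_add_mod (((activeSet P).filter fun k => resid k (ρ w) ≠ 2).filter
      fun k => Fk w k = true).card 2, hoddcard w, pow_succ, pow_mul]
    norm_num
  -- level-set vanishing: `G_s ≡ -1` for `s = 0, 1, 2`
  have hall : ∀ s, s ≤ 2 → ∀ w, G s w = -1 := by
    intro s hs
    have hdeg2 : (2 * Δ + 1) / 2 = Δ := by omega
    have hH : (G s + 1) ∈ lowDeg (ZMod 3) ((2 * Δ + 1) + (2 * Δ + 1)) ((2 * Δ + 1) / 2) := by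
      rw [hdeg2]; exact Submodule.add_mem _ (hG s) (one_mem_lowDeg _)
    have hz := eq_zero_of_vanish_level Δ s hs hH (fun u a hua => by
      have hρw : ρ (Fin.append u a) = s := by
        show ev (uPart _ (Fin.append u a)) + ev (aPart _ (Fin.append u a)) = s
        rw [uPart_append, aPart_append]; exact hua
      rw [Pi.add_apply, Pi.one_apply, ← hρw, hperf]; decide)
    intro w
    have h := congrFun hz w
    rw [Pi.add_apply, Pi.one_apply, Pi.zero_apply] at h
    revert h
    generalize G s w = v
    revert v; decide
  -- the count at the all-`1` parameter point
  let w₀ : Fin ((2 * Δ + 1) + (2 * Δ + 1)) → Bool := fun _ => true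
  let F' : Finset (Fin N) := (activeSet P).filter fun k => Fk w₀ k = true
  have hn : ∀ s, s ≤ 2 → (F'.filter fun k => resid k s ≠ 2).card % 2 = 1 := by
    intro s hs
    have h := hall s hs w₀
    rw [hGval] at h
    have hswap : (((activeSet P).filter fun k => resid k s ≠ 2).filter fun k => Fk w₀ k = true) =
        F'.filter fun k => resid k s ≠ 2 := by
      ext k; simp only [F', mem_filter]; tauto
    rw [hswap] at h
    exact odd_of_neg_one_pow h
  have hsplit : ∀ s, (F'.filter fun k => resid k s ≠ 2).card + (F'.filter fun k => resid k s = 2).card =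
      F'.card := by
    intro s
    rw [add_comm]
    exact card_filter_add_card_filter_not (s := F') (fun k => resid k s = 2)
  have hex : ∀ k : Fin N, resid k 0 = 2 ∨ resid k 1 = 2 ∨ resid k 2 = 2 := by
    intro k; simp only [resid]; split <;> omega
  have huniq : ∀ k : Fin N, ∀ s t, s ≤ 2 → t ≤ 2 → resid k s = 2 → resid k t = 2 → s = t := by
    intro k s t hs ht; simp only [resid]; split <;> omega
  have hcover : (F'.filter fun k => resid k 0 = 2).card + (F'.filter fun k => resid k 1 = 2).card +
      (F'.filter fun k => resid k 2 = 2).card = F'.card := by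
    have hd01 : Disjoint (F'.filter fun k => resid k 0 = 2) (F'.filter fun k => resid k 1 = 2) := by
      rw [disjoint_filter]; intro k _ h1 h2; have := huniq k 0 1 (by omega) (by omega) h1 h2; omega
    have hd2 : Disjoint ((F'.filter fun k => resid k 0 = 2) ∪ (F'.filter fun k => resid k 1 = 2))
        (F'.filter fun k => resid k 2 = 2) := by
      rw [disjoint_union_left, disjoint_filter, disjoint_filter]
      constructor
      · intro k _ h1 h2; have := huniq k 0 2 (by omega) (by omega) h1 h2; omega
      · intro k _ h1 h2; have := huniq k 1 2 (by omega) (by omega) h1 h2; omega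
    rw [← card_union_of_disjoint hd01, ← card_union_of_disjoint hd2]
    congr 1
    ext k
    simp only [mem_union, mem_filter]
    constructor
    · rintro ((⟨h, _⟩ | ⟨h, _⟩) | ⟨h, _⟩) <;> exact h
    · intro h
      rcases hex k with h0 | h1 | h2
      · exact Or.inl (Or.inl ⟨h, h0⟩)
      · exact Or.inl (Or.inr ⟨h, h1⟩)
      · exact Or.inr ⟨h, h2⟩
  have h0 := hn 0 (by omega)
  have h1 := hn 1 (by omega)
  have h2 := hn 2 (by omega)
  have e0 := hsplit 0
  have e1 := hsplit 1
  have e2 := hsplit 2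
  omega


/-- **Sparse-active strategies lose.** If the active outputs of `P` have degree `≤ d` and number `≤ K`, and
`N ≥ (K+1)(48Kd+17)+2`, then `P` loses on some odd pattern: pigeonhole gives one of `K+1` consecutive blocks of
length `48Kd+17` free of active outputs, and `window_free_loses` applies there. -/
theorem sparse_active_loses (d K N : ℕ) (hN : (K + 1) * (24 * (K * (d + d)) + 17) + 2 ≤ N)
    (P : Fin N → CubeFn (ZMod 3) N) (hdeg : ∀ i ∈ activeSet P, P i ∈ lowDeg (ZMod 3) N d)
    (hcard : (activeSet P).card ≤ K) :
    ∃ x : Fin N → Bool, OddZeros x ∧ ¬ Rel x (zOut P x) := by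
  classical
  obtain ⟨B, hB⟩ : ∃ B, B = 24 * (K * (d + d)) + 17 := ⟨_, rfl⟩
  have hN0 : (K + 1) * B + 2 ≤ N := by rw [hB]; exact hN
  obtain ⟨b, hb, hfree⟩ := exists_free_block K B (by omega) (activeSet P) hcard
  have hbB : (b + 1) * B ≤ (K + 1) * B := Nat.mul_le_mul_right B (by omega)
  have hbB' : (b + 1) * B = b * B + B := by ring
  refine window_free_loses d K N (b * B + 2) P hdeg hcard (by omega) (by omega) fun k hk => ?_
  rcases hfree k hk with h | h
  · left; omega
  · right; omega

/-- **Hole law.** If the active outputs of `P` (any number `A` of them, degree `≤ d`) all avoid a window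
`[q, q + 48dA + 17)` of the cycle (`q + 48dA+17 ≤ N`), then `P` loses on some odd pattern.  So a perfect
strategy's active set meets EVERY window of length `48d·#active + 17`: it is spread around the whole ring. -/
theorem hole_loses (d N q : ℕ) (P : Fin N → CubeFn (ZMod 3) N)
    (hdeg : ∀ i ∈ activeSet P, P i ∈ lowDeg (ZMod 3) N d)
    (hq : q + (24 * ((activeSet P).card * (d + d)) + 17) ≤ N)
    (hhole : ∀ k ∈ activeSet P, k.val < q ∨ q + (24 * ((activeSet P).card * (d + d)) + 17) ≤ k.val) :
    ∃ x : Fin N → Bool, OddZeros x ∧ ¬ Rel x (zOut P x) := by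
  refine window_free_loses d (activeSet P).card N (q + 2) P hdeg le_rfl (by omega) (by omega) fun k hk => ?_
  rcases hhole k hk with h | h
  · left; omega
  · right; omega

end Strategy

/-! ## Stage 5: the quantitative law -/

section Law

open Summit.QuantumAdvantage.AdviceFreeQNC0 Literature.Computability.QuantumComplexity
  Literature.Computability.QuantumComplexity.RingHLF

/-- **Perfect strategies are dense-active.** If a strategy on `C_N` is perfect on the odd class, its active
outputs have `𝔽₃`-degree `≤ d`, and `N ≥ (K+1)(48Kd+17)+2`, then it has more than `K` active outputs. -/
theorem card_activeSet_gt_of_perfect (d K N : ℕ) (hN : (K + 1) * (24 * (K * (d + d)) + 17) + 2 ≤ N)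
    (P : Fin N → CubeFn (ZMod 3) N) (hdeg : ∀ i ∈ activeSet P, P i ∈ lowDeg (ZMod 3) N d)
    (hperf : ∀ x : Fin N → Bool, OddZeros x → Rel x (fun i => decide (P i x = 1))) : K < (activeSet P).card := by
  by_contra h
  obtain ⟨x, hx, hrel⟩ := sparse_active_loses d K N hN P hdeg (Nat.not_lt.1 h)
  exact hrel (hperf x hx)

/-- **Perfect strategies have no hole.** If a strategy on `C_N` is perfect on the odd class and its active outputs
have `𝔽₃`-degree `≤ d`, then every window `[q, q + 48d·#active + 17)` inside `[0, N)` contains an active output. -/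
theorem window_meets_activeSet_of_perfect (d N q : ℕ) (P : Fin N → CubeFn (ZMod 3) N)
    (hdeg : ∀ i ∈ activeSet P, P i ∈ lowDeg (ZMod 3) N d)
    (hq : q + (24 * ((activeSet P).card * (d + d)) + 17) ≤ N)
    (hperf : ∀ x : Fin N → Bool, OddZeros x → Rel x (fun i => decide (P i x = 1))) :
    ∃ k ∈ activeSet P, q ≤ k.val ∧ k.val < q + (24 * ((activeSet P).card * (d + d)) + 17) := by
  by_contra h
  push Not at h
  obtain ⟨x, hx, hrel⟩ := hole_loses d N q P hdeg hq fun k hk => by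
    by_cases h1 : q ≤ k.val
    · exact Or.inr (h k hk h1)
    · exact Or.inl (Nat.lt_of_not_le h1)
  exact hrel (hperf x hx)

/-- A strategy with no active output (it agrees with the canonical guess on the odd class) loses, `N ≥ 19`. -/
theorem loses_of_activeSet_empty (N : ℕ) (hN : 19 ≤ N) (P : Fin N → CubeFn (ZMod 3) N)
    (h0 : activeSet P = ∅) :
    ∃ x : Fin N → Bool, OddZeros x ∧ ¬ Rel x (fun i => decide (P i x = 1)) :=
  sparse_active_loses 0 0 N (by simpa using hN) P (fun i hi => by rw [h0] at hi; simp at hi) (by rw [h0]; simp)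

/-- **Dial form** (the node's `closes` with both pieces inlined): if, from some `N₁` on, every degree-`d`
strategy with MORE than `K` active outputs loses, then from `max N₁ ((K+1)(48Kd+17)+2)` on every degree-`d`
strategy loses — the sparse ones by `sparse_active_loses`. -/
theorem noPerfect_of_dense (d K N₁ : ℕ)
    (hdense : ∀ N ≥ N₁, ∀ P : Fin N → CubeFn (ZMod 3) N, (∀ i, P i ∈ lowDeg (ZMod 3) N d) →
      K < (activeSet P).card → ∃ x : Fin N → Bool, OddZeros x ∧ ¬ Rel x (fun i => decide (P i x = 1)))
    (N : ℕ) (hN : max N₁ ((K + 1) * (24 * (K * (d + d)) + 17) + 2) ≤ N) (P : Fin N → CubeFn (ZMod 3) N)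
    (hdeg : ∀ i, P i ∈ lowDeg (ZMod 3) N d) :
    ∃ x : Fin N → Bool, OddZeros x ∧ ¬ Rel x (fun i => decide (P i x = 1)) := by
  rcases Nat.lt_or_ge K (activeSet P).card with h | h
  · exact hdense N (le_of_max_le_left hN) P hdeg h
  · exact sparse_active_loses d K N (le_of_max_le_right hN) P (fun i _ => hdeg i) h

end Law


end Summit.QuantumAdvantage.QuantumAdvantage.Theorems.RingSparseActive
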